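import Summits.HubbardSuperconductivity.HubbardSuperconductivity.Theorems.TwSeededEnsembleEquivalence.Negative.DefectFloor
import Summits.HubbardSuperconductivity.HubbardSuperconductivity.Theorems.TwSeededEnsembleEquivalence.Negative.CouplingTransfer
import Summits.HubbardSuperconductivity.HubbardSuperconductivity.Theorems.TwSeededEnsembleEquivalenceR.Negative.LevelCount

/-!
# Crux `TwSeededEnsembleEquivalenceR` (stmt-HubbardSuperconductivity-15581) — the allowance is load-bearing at EVERY
# temperature scale: a polynomial thermal floor `c₀/β³`

Negative-side support lemmas (refuter, cdisprove gen 1 on the repaired thermal-window crux of route `ThermalWedge`),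
sorry-free and definition-free. Sharpening of TEMPLATE H (`Negative/DefectFloor.lean`, floor `(2/β)log(1+e^{−8β})`,
exponentially small in `β`): the free thermal entropy is carried by the momenta within `1/β` of the Fermi level, of
which there are `≳ (L/(16πβ))²` for EVERY level `μ ∈ [−4,4]` (a box of momenta on the zone diagonal around the point
`(θ,θ)`, `cos θ = −μ/4`), so the defect functional of the crux obeys, uniformly in `L ≥ 16πβ`,
`D_L(β,μ;U,g) ≥ (2/β) log(1 + e^{−1}) (16πβ)⁻² − U − 32g`  — a floor `c₀/β³`, `c₀ = 2log(1+e^{−1})/(256π²) ≈ 2.5·10⁻⁴`.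

* LEVEL COUNT (part A, `LevelCount.lean`, `sq_le_card_filter_abs_torusBand_sub_le`): for `|ν| ≤ 4`, `0 < a ≤ 2`,
  `1 ≤ aL/(16π)`: `#{k : |ε_L(k) − ν| ≤ a} ≥ (aL/(16π))²`.
* `log_partitionFn_free_torus_ge_level`, `log_partitionFn_seededGC_ge_level`, `seeded_defect_floor_level`,
  `seeded_defect_floor_cube` — the refined floors.
* `twSeededEnsembleEquivalenceR_false_of_allowance_lt_cube` — KILL FORM: the repaired crux with allowance `A(β)` is
  FALSE as soon as `A(β₀) < (2/β₀) log(1+e^{−1}) (16πβ₀)⁻²` at ONE `β₀ ≥ 1` (witness `U → 0⁺` with `β₀ ≤ e^{a/U}`,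
  `g = K'U`, `L ≥ 16πβ₀`); `twSeededEnsembleEquivalenceR_false_of_allowance_inv_pow_four` — in particular NO
  allowance `C/β⁴` (any `C`) can replace `log 4/β`: the allowance is load-bearing polynomially at every temperature of
  the window, not only at `β ≈ 1`. (Truth, for calibration: the free thermal excess is `≍ γT²/2`, Sommerfeld.)
-/

set_option linter.dupNamespace false

namespace Summit.HubbardSuperconductivity.HubbardSuperconductivity.Theorems.TwSeededEnsembleEquivalenceR.Negative

open Matrix Literature.MathematicalPhysics.QuantumLattice Literature.Probability.LatticeModels
open Summit.HubbardSuperconductivity.HubbardSuperconductivity.Theorems.TwSeededEnsembleEquivalence.Negative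
open scoped ComplexOrder Matrix.Norms.L2Operator

noncomputable section


/-! ### The refined free floor: entropy of the levels within `a` of the Fermi level -/

/-- **Free thermal entropy near the level.** For `L ≥ 3`, `β ≥ 0`, every `μ` and every `a`:
`−2β Σ_k min(ε_L(k) − μ, 0) + 2 log(1 + e^{−βa})·#{k : |ε_L(k) − μ| ≤ a} ≤ log Re Z_β(hubbardTorusWith 2 L 1 0 μ)`. [folklore] -/
theorem log_partitionFn_free_torus_ge_level (L : ℕ) [NeZero L] (hL : 3 ≤ L) {β : ℝ} (hβ : 0 ≤ β) (μ a : ℝ) :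
    -(2 * β * ∑ k : TorusSite 2 L, min (torusBand L k - μ) 0) +
        2 * Real.log (1 + Real.exp (-(β * a))) *
          ((Finset.univ.filter fun k : TorusSite 2 L => |torusBand L k - μ| ≤ a).card : ℝ) ≤
      Real.log (partitionFn β (hubbardTorusWith 2 L 1 0 μ)).re := by
  classical
  have hZ := partitionFn_dWaveSourceTorus_zero_re hL β μ 0
  rw [dWaveSourceTorus_zero] at hZ
  have hsimp : ∀ k : TorusSite 2 L, Real.sqrt ((torusBand L k - μ) ^ 2 + (2 * Real.sqrt 2 * 0 * dWaveGap k) ^ 2) =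
      |torusBand L k - μ| := fun k => by
    rw [mul_zero, zero_mul, zero_pow two_ne_zero, add_zero, Real.sqrt_sq_eq_abs]
  simp_rw [hsimp] at hZ
  rw [hZ, card_orb_fermionTorus_two]
  have hpow : (0 : ℝ) < (2 : ℝ) ^ (2 * L ^ 2) := by positivity
  have hfac : ∀ k : TorusSite 2 L, Real.exp (-(β * (torusBand L k - μ))) *
      ((1 + Real.cosh (β * |torusBand L k - μ|)) / 2) ≠ 0 := fun k => by
    have := Real.one_le_cosh (β * |torusBand L k - μ|); positivity
  rw [Real.log_mul hpow.ne' (Finset.prod_ne_zero_iff.2 fun k _ => hfac k),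
    Real.log_prod (s := Finset.univ) (hf := fun k _ => hfac k), Real.log_pow]
  set c := Real.log (1 + Real.exp (-(β * a))) with hc
  -- per mode: keep the mode's own entropy, then compare with the level indicator
  have hmode : ∀ k : TorusSite 2 L,
      (-(β * (torusBand L k - μ)) + β * |torusBand L k - μ|) +
        2 * c * (if |torusBand L k - μ| ≤ a then 1 else 0) - Real.log 4 ≤
      Real.log (Real.exp (-(β * (torusBand L k - μ))) * ((1 + Real.cosh (β * |torusBand L k - μ|)) / 2)) := by
    intro k
    have h1 := log_freeModeFactor_ge (ξ := torusBand L k - μ) hβ le_rfl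
    have h2 : 2 * c * (if |torusBand L k - μ| ≤ a then 1 else 0) ≤
        2 * Real.log (1 + Real.exp (-(β * |torusBand L k - μ|))) := by
      split_ifs with h
      · rw [mul_one]
        refine mul_le_mul_of_nonneg_left (Real.log_le_log (by positivity) ?_) (by norm_num)
        apply add_le_add le_rfl
        exact Real.exp_le_exp.2 (by nlinarith)
      · rw [mul_zero]
        have : 0 ≤ Real.log (1 + Real.exp (-(β * |torusBand L k - μ|))) :=
          Real.log_nonneg (by linarith [Real.exp_pos (-(β * |torusBand L k - μ|))])
        linarith
    linarith
  have hlo := Finset.sum_le_sum fun k (_ : k ∈ Finset.univ) => hmode k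
  have hid : ∀ k : TorusSite 2 L, -(β * (torusBand L k - μ)) + β * |torusBand L k - μ| =
      -2 * β * min (torusBand L k - μ) 0 := fun k => by
    have := neg_add_abs_eq (torusBand L k - μ)
    linear_combination β * this
  simp_rw [hid] at hlo
  rw [Finset.sum_sub_distrib, Finset.sum_add_distrib, Finset.sum_const, Finset.card_univ,
    card_torusSite_two, nsmul_eq_mul, ← Finset.mul_sum, ← Finset.mul_sum, Finset.sum_boole] at hlo
  have hlog4 : Real.log 4 = 2 * Real.log 2 := by
    rw [show (4 : ℝ) = 2 ^ 2 by norm_num, Real.log_pow]; push_cast; ring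
  have hcast : ((L ^ 2 : ℕ) : ℝ) = (L : ℝ) ^ 2 := by push_cast; ring
  have hcast2 : ((2 * L ^ 2 : ℕ) : ℝ) = 2 * (L : ℝ) ^ 2 := by push_cast; ring
  rw [hcast] at hlo
  rw [hcast2]
  rw [hlog4] at hlo
  linarith

/-- The same through the free ground energy: `−βE₀(K⁰_μ) + 2 log(1 + e^{−βa})·#{k : |ε_L(k) − μ| ≤ a} ≤ log Re Z_β(K⁰_μ)`. -/
theorem log_partitionFn_free_torus_ge_groundEnergy_level (L : ℕ) [NeZero L] (hL : 3 ≤ L) {β : ℝ} (hβ : 0 ≤ β)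
    (μ a : ℝ) :
    -(β * (hubbardTorusWith 2 L 1 0 μ).groundEnergy) +
        2 * Real.log (1 + Real.exp (-(β * a))) *
          ((Finset.univ.filter fun k : TorusSite 2 L => |torusBand L k - μ| ≤ a).card : ℝ) ≤
      Real.log (partitionFn β (hubbardTorusWith 2 L 1 0 μ)).re := by
  have h := log_partitionFn_free_torus_ge_level L hL hβ μ a
  rw [groundEnergy_hubbardTorusWith_zero hL μ]
  linarith

/-- **Pressure floor for the seeded model, level form.** For `L ≥ 3`, `U ≥ 0`, `g ≥ 0`, `β ≥ 0`, every `μ`, `a`: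
`log Re Z_β(Hgc(U,μ,g)) ≥ −β E₀(K⁰_μ) + 2 log(1 + e^{−βa})·#{k : |ε_L(k) − μ| ≤ a} − βUL²`. [folklore] -/
theorem log_partitionFn_seededGC_ge_level (L : ℕ) [NeZero L] (hL : 3 ≤ L) {U g β : ℝ} (hU : 0 ≤ U)
    (hg : 0 ≤ g) (hβ : 0 ≤ β) (μ a : ℝ) :
    -(β * (hubbardTorusWith 2 L 1 0 μ).groundEnergy) +
        2 * Real.log (1 + Real.exp (-(β * a))) *
          ((Finset.univ.filter fun k : TorusSite 2 L => |torusBand L k - μ| ≤ a).card : ℝ) -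
        β * U * (L : ℝ) ^ 2 ≤
      Real.log (partitionFn β (hubbardTorusWith 2 L 1 U μ - ((g / (L : ℝ) ^ 2 : ℝ) : ℂ) •
        ((pairField dWaveFormFactor L)ᴴ * pairField dWaveFormFactor L))).re := by
  have hLpos : (0 : ℝ) < (L : ℝ) ^ 2 := cast_sq_pos_of_neZero L
  -- (a) drop the seed
  have hseed : Real.log (partitionFn β (hubbardTorusWith 2 L 1 U μ)).re ≤
      Real.log (partitionFn β (hubbardTorusWith 2 L 1 U μ - ((g / (L : ℝ) ^ 2 : ℝ) : ℂ) •
        ((pairField dWaveFormFactor L)ᴴ * pairField dWaveFormFactor L))).re := by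
    refine log_partitionFn_le_of_posSemidef (isHermitian_seededGC L U μ g) (isHermitian_hubbardTorusWith L 1 U μ)
      hβ ?_
    rw [sub_sub_cancel]
    exact (pairField_conjTranspose_mul_self_posSemidef dWaveFormFactor L).smul
      (Complex.zero_le_real.2 (div_nonneg hg hLpos.le))
  -- (b) bound the repulsion by `U L²`
  have hW : hubbardTorusWith 2 L 1 U μ =
      hubbardTorusWith 2 L 1 0 μ + (U : ℂ) • ∑ x : FermionTorus 2 L, numberOp x 0 * numberOp x 1 := by
    have h := hamiltonianWith_sub_hamiltonianWith (fermionTorusGraph 2 L) 1 0 U μ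
    rw [sub_zero] at h
    change hubbardTorusWith 2 L 1 U μ - hubbardTorusWith 2 L 1 0 μ = _ at h
    rw [← h]; abel
  have hWnorm : ‖(U : ℂ) • ∑ x : FermionTorus 2 L,
      (numberOp x 0 * numberOp x 1 : Matrix (Finset (Orb (FermionTorus 2 L))) (Finset (Orb (FermionTorus 2 L))) ℂ)‖ ≤
      U * (L : ℝ) ^ 2 := by
    rw [norm_smul, Complex.norm_real, Real.norm_of_nonneg hU]
    refine mul_le_mul_of_nonneg_left ?_ hU
    calc ‖∑ x : FermionTorus 2 L,
          (numberOp x 0 * numberOp x 1 : Matrix (Finset (Orb (FermionTorus 2 L))) (Finset (Orb (FermionTorus 2 L))) ℂ)‖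
        ≤ ∑ x : FermionTorus 2 L,
          ‖(numberOp x 0 * numberOp x 1 : Matrix (Finset (Orb (FermionTorus 2 L))) (Finset (Orb (FermionTorus 2 L))) ℂ)‖ :=
          norm_sum_le _ _
      _ ≤ ∑ _x : FermionTorus 2 L, (1 : ℝ) := Finset.sum_le_sum fun x _ =>
          (norm_mul_le _ _).trans (mul_le_one₀ (norm_numberOp_le_one x 0) (norm_nonneg _) (norm_numberOp_le_one x 1))
      _ = (L : ℝ) ^ 2 := by
          rw [Finset.sum_const, Finset.card_univ, card_fermionTorus, nsmul_eq_mul, mul_one]; push_cast; ring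
  have hrep : Real.log (partitionFn β (hubbardTorusWith 2 L 1 0 μ)).re -
      Real.log (partitionFn β (hubbardTorusWith 2 L 1 U μ)).re ≤ β * (U * (L : ℝ) ^ 2) := by
    refine (log_partitionFn_sub_log_partitionFn_le (isHermitian_hubbardTorusWith L 1 0 μ)
      (isHermitian_hubbardTorusWith L 1 U μ) hβ).trans ?_
    rw [hW, add_sub_cancel_left]
    exact mul_le_mul_of_nonneg_left hWnorm hβ
  -- (c) the free level floor
  have hfree := log_partitionFn_free_torus_ge_groundEnergy_level L hL hβ μ a
  nlinarith [hfree, hrep, hseed]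

/-- **TEMPLATE H′ — THE LEVEL FLOOR.** For `L ≥ 3`, `U, g ≥ 0`, `β > 0`, every `μ`, `a` and every sector `K ≠ ⊥` of
`N`-particle vectors: `(2/β) log(1 + e^{−βa})·#{k : |ε_L(k) − μ| ≤ a}/L² − U − 32g ≤ minE(Hcan,K)/L² + log Re Z/(βL²) − μN/L²`. -/
theorem seeded_defect_floor_level (L : ℕ) [NeZero L] (hL : 3 ≤ L) {U g β : ℝ} (hU : 0 ≤ U) (hg : 0 ≤ g)
    (hβ : 0 < β) (μ a : ℝ) {N : ℕ} (K : Submodule ℂ (Fock (Orb (FermionTorus 2 L)))) (hK : K ≠ ⊥)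
    (hKN : ∀ ψ ∈ K, IsNParticle N ψ) :
    2 / β * Real.log (1 + Real.exp (-(β * a))) *
          ((Finset.univ.filter fun k : TorusSite 2 L => |torusBand L k - μ| ≤ a).card : ℝ) / (L : ℝ) ^ 2 - U - 32 * g ≤
      (hubbardTorus 2 L 1 U - ((g / (L : ℝ) ^ 2 : ℝ) : ℂ) •
          ((pairField dWaveFormFactor L)ᴴ * pairField dWaveFormFactor L)).minEnergyOn K / (L : ℝ) ^ 2 +
        Real.log (partitionFn β (hubbardTorusWith 2 L 1 U μ - ((g / (L : ℝ) ^ 2 : ℝ) : ℂ) •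
          ((pairField dWaveFormFactor L)ᴴ * pairField dWaveFormFactor L))).re / (β * (L : ℝ) ^ 2) -
        μ * N / (L : ℝ) ^ 2 := by
  have hLpos : (0 : ℝ) < (L : ℝ) ^ 2 := cast_sq_pos_of_neZero L
  have hβL : 0 < β * (L : ℝ) ^ 2 := mul_pos hβ hLpos
  -- T = 0 chain: minE − μN ≥ E₀(Hgc U g) ≥ E₀(Hgc 0 g) ≥ E₀(K⁰_μ) − 32 g L²
  have h1 := groundEnergy_seededGC_add_le_minEnergyOn L U μ g K hK hKN
  have h2 := groundEnergy_seededGC_mono_U L hU μ g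
  have h3 := groundEnergy_seededGC_le_add L 0 μ (g₀ := 0) hg
  have h30 : hubbardTorusWith 2 L 1 0 μ - ((0 / (L : ℝ) ^ 2 : ℝ) : ℂ) •
      ((pairField dWaveFormFactor L)ᴴ * pairField dWaveFormFactor L) = hubbardTorusWith 2 L 1 0 μ := by
    rw [zero_div, Complex.ofReal_zero, zero_smul, sub_zero]
  rw [h30, sub_zero] at h3
  -- thermal chain
  have h4 := log_partitionFn_seededGC_ge_level L hL hU hg hβ.le μ a
  set A := (hubbardTorus 2 L 1 U - ((g / (L : ℝ) ^ 2 : ℝ) : ℂ) •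
    ((pairField dWaveFormFactor L)ᴴ * pairField dWaveFormFactor L)).minEnergyOn K
  set Z := Real.log (partitionFn β (hubbardTorusWith 2 L 1 U μ - ((g / (L : ℝ) ^ 2 : ℝ) : ℂ) •
    ((pairField dWaveFormFactor L)ᴴ * pairField dWaveFormFactor L))).re
  set E := (hubbardTorusWith 2 L 1 0 μ).groundEnergy
  set M := 2 * Real.log (1 + Real.exp (-(β * a))) *
    ((Finset.univ.filter fun k : TorusSite 2 L => |torusBand L k - μ| ≤ a).card : ℝ)
  have hA : E - 32 * g * (L : ℝ) ^ 2 ≤ A - μ * N := by linarith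
  have hZ : -(β * E) + M - β * U * (L : ℝ) ^ 2 ≤ Z := h4
  have hZ' : -(E / (L : ℝ) ^ 2) + M / (β * (L : ℝ) ^ 2) - U ≤ Z / (β * (L : ℝ) ^ 2) := by
    rw [le_div_iff₀ hβL]
    have : (-(E / (L : ℝ) ^ 2) + M / (β * (L : ℝ) ^ 2) - U) * (β * (L : ℝ) ^ 2) =
        -(β * E) + M - β * U * (L : ℝ) ^ 2 := by
      field_simp
    linarith
  have hA' : (E - 32 * g * (L : ℝ) ^ 2) / (L : ℝ) ^ 2 ≤ (A - μ * N) / (L : ℝ) ^ 2 :=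
    div_le_div_of_nonneg_right hA hLpos.le
  have e1 : (E - 32 * g * (L : ℝ) ^ 2) / (L : ℝ) ^ 2 = E / (L : ℝ) ^ 2 - 32 * g := by
    rw [sub_div, mul_div_assoc, div_self hLpos.ne', mul_one]
  have e2 : (A - μ * N) / (L : ℝ) ^ 2 = A / (L : ℝ) ^ 2 - μ * N / (L : ℝ) ^ 2 := by rw [sub_div]
  have e3 : M / (β * (L : ℝ) ^ 2) = 2 / β * Real.log (1 + Real.exp (-(β * a))) *
      ((Finset.univ.filter fun k : TorusSite 2 L => |torusBand L k - μ| ≤ a).card : ℝ) / (L : ℝ) ^ 2 := by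
    simp only [M]
    field_simp
  rw [e1, e2] at hA'
  rw [e3] at hZ'
  linarith

/-- **The polynomial floor at the crux's sector.** For `L ≥ 3` with `16πβ ≤ L`, `U, g ≥ 0`, `β ≥ 1`, `|μ| ≤ 4`, `0 ≤ δ`:
`(2/β) log(1 + e^{−1}) (16πβ)⁻² − U − 32g ≤ D_L(β,μ;U,g)` (level window `a = 1/β`). [folklore] -/
theorem seeded_defect_floor_cube (L : ℕ) [NeZero L] (hL : 3 ≤ L) {U g β μ δ : ℝ} (hU : 0 ≤ U) (hg : 0 ≤ g)
    (hβ : 1 ≤ β) (hμ : |μ| ≤ 4) (hδ : 0 ≤ δ) (hLβ : 16 * Real.pi * β ≤ L) :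
    2 / β * Real.log (1 + Real.exp (-1)) * (1 / (16 * Real.pi * β)) ^ 2 - U - 32 * g ≤
      (hubbardTorus 2 L 1 U - ((g / (L : ℝ) ^ 2 : ℝ) : ℂ) •
          ((pairField dWaveFormFactor L)ᴴ * pairField dWaveFormFactor L)).minEnergyOn
          (szSector (Λ := FermionTorus 2 L) (2 * ⌊(1 - δ) * (L : ℝ) ^ 2 / 2⌋₊) 0) / (L : ℝ) ^ 2 +
        Real.log (partitionFn β (hubbardTorusWith 2 L 1 U μ - ((g / (L : ℝ) ^ 2 : ℝ) : ℂ) •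
          ((pairField dWaveFormFactor L)ᴴ * pairField dWaveFormFactor L))).re / (β * (L : ℝ) ^ 2) -
        μ * (2 * (⌊(1 - δ) * (L : ℝ) ^ 2 / 2⌋₊ : ℝ)) / (L : ℝ) ^ 2 := by
  have hπ := Real.pi_pos
  have hβpos : 0 < β := lt_of_lt_of_le one_pos hβ
  have hLpos : (0 : ℝ) < (L : ℝ) ^ 2 := cast_sq_pos_of_neZero L
  have hLr : (0 : ℝ) < L := by
    have : 0 < L := Nat.pos_of_ne_zero (NeZero.ne L)
    exact_mod_cast this
  have h := seeded_defect_floor_level L hL hU hg hβpos μ (1 / β) (N := 2 * ⌊(1 - δ) * (L : ℝ) ^ 2 / 2⌋₊)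
    (szSector (Λ := FermionTorus 2 L) (2 * ⌊(1 - δ) * (L : ℝ) ^ 2 / 2⌋₊) 0) (szSector_floor_ne_bot L hδ)
    (fun ψ hψ => ((mem_szSector_iff _ _ ψ).1 hψ).1)
  have hcast : ((2 * ⌊(1 - δ) * (L : ℝ) ^ 2 / 2⌋₊ : ℕ) : ℝ) = 2 * (⌊(1 - δ) * (L : ℝ) ^ 2 / 2⌋₊ : ℝ) := by
    push_cast; ring
  rw [hcast] at h
  -- the count with a = 1/β
  have ha2 : 1 / β ≤ 2 := by rw [div_le_iff₀ hβpos]; linarith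
  have hcond : 1 ≤ 1 / β * L / (16 * Real.pi) := by
    rw [le_div_iff₀ (by positivity), one_div_mul_eq_div, le_div_iff₀ hβpos]
    linarith
  have hcnt := sq_le_card_filter_abs_torusBand_sub_le (L := L) (ν := μ) hμ (one_div_pos.2 hβpos) ha2 hcond
  have hβa : Real.exp (-(β * (1 / β))) = Real.exp (-1) := by rw [mul_one_div_cancel hβpos.ne']
  rw [hβa] at h
  have hc0 : 0 ≤ 2 / β * Real.log (1 + Real.exp (-1)) := by
    have : 0 ≤ Real.log (1 + Real.exp (-1)) := Real.log_nonneg (by linarith [Real.exp_pos (-1 : ℝ)])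
    positivity
  have hkey : 2 / β * Real.log (1 + Real.exp (-1)) * (1 / (16 * Real.pi * β)) ^ 2 ≤
      2 / β * Real.log (1 + Real.exp (-1)) *
        ((Finset.univ.filter fun k : TorusSite 2 L => |torusBand L k - μ| ≤ 1 / β).card : ℝ) / (L : ℝ) ^ 2 := by
    rw [mul_div_assoc]
    refine mul_le_mul_of_nonneg_left ?_ hc0
    rw [le_div_iff₀ hLpos]
    have e : (1 / (16 * Real.pi * β)) ^ 2 * (L : ℝ) ^ 2 = (1 / β * L / (16 * Real.pi)) ^ 2 := by
      field_simp
    rw [e]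
    exact hcnt
  linarith

/-! ### Kill forms -/

/-- **Any allowance below the polynomial floor at one temperature is refuted (repaired crux shape).** If
`A(β₀) < (2/β₀) log(1 + e^{−1}) (16πβ₀)⁻²` at some `β₀ ≥ 1`, the variant of `TwSeededEnsembleEquivalenceR` with
allowance `A(β)` in place of `log 4/β` is FALSE (witness: `δ = 1/10`, `β = β₀`, `U → 0⁺` with `β₀ ≤ e^{a/U}`, `g = K'U`,
`L ≥ max(L₀, 3, 16πβ₀)`). [folklore] -/
theorem twSeededEnsembleEquivalenceR_false_of_allowance_lt_cube (A : ℝ → ℝ) {β₀ : ℝ} (hβ₀ : 1 ≤ β₀)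
    (hA : A β₀ < 2 / β₀ * Real.log (1 + Real.exp (-1)) * (1 / (16 * Real.pi * β₀)) ^ 2) :
    ¬ (∀ δ ∈ Set.Icc (1/10 : ℝ) (2/5 : ℝ), ∃ μ₁ μ₂ : ℝ, -4 < μ₁ ∧ μ₁ ≤ μ₂ ∧ μ₂ < 0 ∧
        ∃ a K' U₀ : ℝ, 0 < a ∧ 0 < K' ∧ 0 < U₀ ∧ ∀ U ∈ Set.Ioc (0 : ℝ) U₀, ∀ g ∈ Set.Icc (K' * U) (1 / 10),
          ∀ β : ℝ, 1 ≤ β → β ≤ Real.exp (a / U) →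
            ∃ μ ∈ Set.Icc μ₁ μ₂, ∀ ε : ℝ, 0 < ε → ∃ L₀ : ℕ, ∀ (L : ℕ) [NeZero L], L₀ ≤ L →
              (((hubbardTorus 2 L 1 U - ((g / (L : ℝ) ^ 2 : ℝ) : ℂ) •
                ((pairField dWaveFormFactor L)ᴴ * pairField dWaveFormFactor L))).minEnergyOn
                  (szSector (Λ := FermionTorus 2 L) (2 * ⌊(1 - δ) * (L : ℝ) ^ 2 / 2⌋₊) 0) / (L : ℝ) ^ 2) +
                (Real.log (Matrix.partitionFn β (hubbardTorusWith 2 L 1 U μ - ((g / (L : ℝ) ^ 2 : ℝ) : ℂ) •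
                  ((pairField dWaveFormFactor L)ᴴ * pairField dWaveFormFactor L))).re / (β * (L : ℝ) ^ 2)) -
                μ * ((2 * ⌊(1 - δ) * (L : ℝ) ^ 2 / 2⌋₊) : ℝ) / (L : ℝ) ^ 2 ≤ A β + ε) := by
  intro H
  have hπ := Real.pi_pos
  set c := 2 / β₀ * Real.log (1 + Real.exp (-1)) * (1 / (16 * Real.pi * β₀)) ^ 2 - A β₀ with hc
  have hcpos : 0 < c := by rw [hc]; linarith
  have hδ : (1/10 : ℝ) ∈ Set.Icc (1/10 : ℝ) (2/5 : ℝ) := ⟨le_rfl, by norm_num⟩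
  obtain ⟨μ₁, μ₂, hμ₁, hμ₁₂, hμ₂, a, K', U₀, ha, hK', hU₀, hU⟩ := H (1/10) hδ
  have hlog : 0 ≤ Real.log β₀ := Real.log_nonneg hβ₀
  have hlog1 : 0 < Real.log β₀ + 1 := by linarith
  set U : ℝ := min U₀ (min (c / 4) (min (c / (128 * K')) (min (1 / (10 * K')) (a / (Real.log β₀ + 1)))))
    with hUdef
  have hUpos : 0 < U := by
    rw [hUdef]
    refine lt_min hU₀ (lt_min (by positivity) (lt_min (by positivity) (lt_min (by positivity) (by positivity))))
  have hUU₀ : U ≤ U₀ := min_le_left _ _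
  have hUc : U ≤ c / 4 := (min_le_right _ _).trans (min_le_left _ _)
  have hUcK : U ≤ c / (128 * K') := (min_le_right _ _).trans ((min_le_right _ _).trans (min_le_left _ _))
  have hUK : U ≤ 1 / (10 * K') :=
    (min_le_right _ _).trans ((min_le_right _ _).trans ((min_le_right _ _).trans (min_le_left _ _)))
  have hUa : U ≤ a / (Real.log β₀ + 1) :=
    (min_le_right _ _).trans ((min_le_right _ _).trans ((min_le_right _ _).trans (min_le_right _ _)))
  have hUm : U ∈ Set.Ioc (0 : ℝ) U₀ := ⟨hUpos, hUU₀⟩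
  have hg32 : 32 * (K' * U) ≤ c / 4 := by
    have h := mul_le_mul_of_nonneg_left hUcK hK'.le
    have e : K' * (c / (128 * K')) = c / 128 := by field_simp
    rw [e] at h
    linarith
  have hgm : K' * U ∈ Set.Icc (K' * U) (1 / 10) := by
    refine ⟨le_rfl, ?_⟩
    have h := mul_le_mul_of_nonneg_left hUK hK'.le
    have e : K' * (1 / (10 * K')) = 1 / 10 := by field_simp
    linarith [h, e.le, e.ge]
  have hβexp : β₀ ≤ Real.exp (a / U) := by
    have h1 : Real.log β₀ ≤ a / U := by
      rw [le_div_iff₀ hUpos]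
      have h2 : U * (Real.log β₀ + 1) ≤ a := by
        have := mul_le_mul_of_nonneg_right hUa hlog1.le
        rwa [div_mul_cancel₀ _ hlog1.ne'] at this
      nlinarith
    calc β₀ = Real.exp (Real.log β₀) := (Real.exp_log (lt_of_lt_of_le one_pos hβ₀)).symm
      _ ≤ Real.exp (a / U) := Real.exp_le_exp.2 h1
  obtain ⟨μ, hμm, hμ⟩ := hU U hUm (K' * U) hgm β₀ hβ₀ hβexp
  obtain ⟨L₀, hL₀⟩ := hμ (c / 4) (by positivity)
  obtain ⟨L₁, hL₁⟩ := exists_nat_gt (16 * Real.pi * β₀)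
  set L : ℕ := max L₀ (max 3 L₁) with hLdef
  haveI : NeZero L := ⟨by omega⟩
  have hL3 : 3 ≤ L := (le_max_left _ _).trans (le_max_right _ _)
  have hL1 : (L₁ : ℝ) ≤ L := by
    have : L₁ ≤ L := (le_max_right _ _).trans (le_max_right _ _)
    exact_mod_cast this
  have hinst := hL₀ L (le_max_left _ _)
  have hμabs : |μ| ≤ 4 := by
    rw [abs_le]; constructor <;> linarith [hμm.1, hμm.2]
  have hfloor := seeded_defect_floor_cube L hL3 (U := U) (g := K' * U) (δ := 1/10) hUpos.le
    (mul_nonneg hK'.le hUpos.le) hβ₀ hμabs (by norm_num) (by linarith)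
  change _ ≤ A β₀ + c / 4 at hinst
  linarith

/-- `1 + e^{−1} > 1`, so the floor constant is positive. -/
theorem log_one_add_exp_neg_one_pos : 0 < Real.log (1 + Real.exp (-1)) :=
  Real.log_pos (by linarith [Real.exp_pos (-1 : ℝ)])

/-- **No `O(β⁻⁴)` allowance**: for every constant `C`, `TwSeededEnsembleEquivalenceR` with `log 4/β` replaced by `C/β⁴`
is FALSE (take `β₀ > max(1, 256π² C/(2 log(1+e^{−1})))`). The allowance is load-bearing at every temperature scale of
the window `[1, e^{a/U}]`, polynomially — not only near `β = 1`. -/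
theorem twSeededEnsembleEquivalenceR_false_of_allowance_inv_pow_four (C : ℝ) :
    ¬ (∀ δ ∈ Set.Icc (1/10 : ℝ) (2/5 : ℝ), ∃ μ₁ μ₂ : ℝ, -4 < μ₁ ∧ μ₁ ≤ μ₂ ∧ μ₂ < 0 ∧
        ∃ a K' U₀ : ℝ, 0 < a ∧ 0 < K' ∧ 0 < U₀ ∧ ∀ U ∈ Set.Ioc (0 : ℝ) U₀, ∀ g ∈ Set.Icc (K' * U) (1 / 10),
          ∀ β : ℝ, 1 ≤ β → β ≤ Real.exp (a / U) →
            ∃ μ ∈ Set.Icc μ₁ μ₂, ∀ ε : ℝ, 0 < ε → ∃ L₀ : ℕ, ∀ (L : ℕ) [NeZero L], L₀ ≤ L →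
              (((hubbardTorus 2 L 1 U - ((g / (L : ℝ) ^ 2 : ℝ) : ℂ) •
                ((pairField dWaveFormFactor L)ᴴ * pairField dWaveFormFactor L))).minEnergyOn
                  (szSector (Λ := FermionTorus 2 L) (2 * ⌊(1 - δ) * (L : ℝ) ^ 2 / 2⌋₊) 0) / (L : ℝ) ^ 2) +
                (Real.log (Matrix.partitionFn β (hubbardTorusWith 2 L 1 U μ - ((g / (L : ℝ) ^ 2 : ℝ) : ℂ) •
                  ((pairField dWaveFormFactor L)ᴴ * pairField dWaveFormFactor L))).re / (β * (L : ℝ) ^ 2)) -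
                μ * ((2 * ⌊(1 - δ) * (L : ℝ) ^ 2 / 2⌋₊) : ℝ) / (L : ℝ) ^ 2 ≤ C / β ^ 4 + ε) := by
  have hπ := Real.pi_pos
  set ℓ := Real.log (1 + Real.exp (-1)) with hℓ
  have hℓpos : 0 < ℓ := log_one_add_exp_neg_one_pos
  -- β₀ := max 1 (256 π² C/(2ℓ) + 1)
  set β₀ : ℝ := max 1 (256 * Real.pi ^ 2 * C / (2 * ℓ) + 1) with hβ₀
  have hβ₀1 : 1 ≤ β₀ := le_max_left _ _
  have hβ₀pos : 0 < β₀ := lt_of_lt_of_le one_pos hβ₀1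
  refine twSeededEnsembleEquivalenceR_false_of_allowance_lt_cube (fun β => C / β ^ 4) hβ₀1 ?_
  show C / β₀ ^ 4 < 2 / β₀ * ℓ * (1 / (16 * Real.pi * β₀)) ^ 2
  have e : 2 / β₀ * ℓ * (1 / (16 * Real.pi * β₀)) ^ 2 = (2 * ℓ / (256 * Real.pi ^ 2)) / β₀ ^ 3 := by
    field_simp; ring
  rw [e, div_lt_div_iff₀ (by positivity) (by positivity)]
  have hC : C < 2 * ℓ / (256 * Real.pi ^ 2) * β₀ := by
    have h1 : 256 * Real.pi ^ 2 * C / (2 * ℓ) + 1 ≤ β₀ := le_max_right _ _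
    have h2 : 256 * Real.pi ^ 2 * C / (2 * ℓ) < β₀ := by linarith
    rw [div_lt_iff₀ (by positivity)] at h2
    rw [div_mul_eq_mul_div, lt_div_iff₀ (by positivity)]
    linarith
  have hβ3 : 0 < β₀ ^ 3 := by positivity
  calc C * β₀ ^ 3 < 2 * ℓ / (256 * Real.pi ^ 2) * β₀ * β₀ ^ 3 := by nlinarith
    _ = 2 * ℓ / (256 * Real.pi ^ 2) * β₀ ^ 4 := by ring

end

end Summit.HubbardSuperconductivity.HubbardSuperconductivity.Theorems.TwSeededEnsembleEquivalenceR.Negative
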